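import Mathlib
import HarnessLib

/-!
# The antiperiodic time kernel of a fermionic mode at complex energy and its smooth frequency truncations as row averages

Topic `MathematicalPhysics/QuantumLattice`; analysis on the imaginary-time circle for the Matsubara-UV step of the cell
gate-hubbard-kl (R0, ARCH-β P3): the device that transports the Pedra–Salmhofer determinant bound (which lives in imaginary
TIME: de Siqueira Pedra–Salmhofer 2008, Thm 2.4; tree `MatsubaraDeterminantBound(Weighted)`) to a covariance given by a FINITE,
smoothly weighted sum over fermionic Matsubara frequencies (the Grassmann algebras of the tree carry `2M` frequencies).

For a complex "energy" `E` (`= ξ - iθ`: band energy at a complex chemical potential) and inverse temperature `β`, the time-ordered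
kernel on the window `σ, t ∈ [0, β]` is
`K_β(E; σ, t) = -e^{(σ-t)E}/(1 + e^{βE})` if `t < σ`, `= e^{(σ-t)E}/(1 + e^{-βE})` if `σ ≤ t` (`fermiTimeKernel`; the two branches of
BGM 2006 (1.4) / Pedra–Salmhofer §4.1, continued to complex `E`).  Its fermionic Fourier coefficients are the free propagator:

* **`integral_exp_mul_fermiTimeKernel`** — for `e^{-iωβ} = -1` (a fermionic frequency) and `t ∈ [0, β]`,
  `∫₀^β e^{-iωσ} K_β(E; σ, t) dσ = e^{-iωt}/(E - iω)` (two exponential integrals; the boundary terms cancel exactly because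
  `e^{βE}/(1+e^{βE}) = 1/(1+e^{-βE})`);
* `freqKernel β ω c s = (1/β) Σ_n c_n e^{iω_n s}` — the synthesis kernel of a finite family of weights `c_n` at fermionic
  frequencies `ω_n`; **`integral_freqKernel_mul_fermiTimeKernel`** — the ROW-AVERAGE IDENTITY
  `∫₀^β F_c(τ - σ) K_β(E; σ, t) dσ = (1/β) Σ_n c_n e^{iω_n(τ - t)}/(E - iω_n)`: a smoothly truncated frequency sum of the free
  propagator is an average, with complex weight `F_c(τ - ·)`, of time translates of the chronological kernel — so its determinants
  inherit the Pedra–Salmhofer bound by multilinearity (`Literature.Analysis.Matrix.norm_det_row_integral_le`).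

Everything is PROVED; the definitions are the kernel and the synthesis kernel; no named facts.

## Sources

W. de Siqueira Pedra, M. Salmhofer, Comm. Math. Phys. 282 (2008) 797–818, §2 (2.8)–(2.10), §4.1, Thm 2.4 [`PedraSalmhofer2008`];
G. Benfatto, A. Giuliani, V. Mastropietro, Ann. Henri Poincaré 7 (2006) 809–898, §1.2 (1.4), §2.1 (2.3) [`BenfattoGiulianiMastropietro2006`].
-/

noncomputable section

open MeasureTheory Set Finset intervalIntegral
open scoped Interval

namespace Literature.MathematicalPhysics.QuantumLattice

/-! ### The two-branch time kernel at complex energy -/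

/-- **The time-ordered kernel of a fermionic mode with complex energy `E` at inverse temperature `β`** on the window
`σ, t ∈ [0, β]`: `-e^{(σ-t)E}(1+e^{βE})⁻¹` for `t < σ` and `e^{(σ-t)E}(1+e^{-βE})⁻¹` for `σ ≤ t` (BGM 2006 (1.4); Pedra–Salmhofer
§4.1, continued to complex `E`). [cite: PedraSalmhofer2008, §4.1] -/
def fermiTimeKernel (β : ℝ) (E : ℂ) (σ t : ℝ) : ℂ :=
  if t < σ then -(Complex.exp (((σ - t : ℝ) : ℂ) * E) / (1 + Complex.exp ((β : ℂ) * E)))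
  else Complex.exp (((σ - t : ℝ) : ℂ) * E) / (1 + Complex.exp (-((β : ℂ) * E)))

/-- The branch `σ ≤ t` of the kernel. [cite: PedraSalmhofer2008, §4.1] -/
theorem fermiTimeKernel_of_le (β : ℝ) (E : ℂ) {σ t : ℝ} (h : σ ≤ t) :
    fermiTimeKernel β E σ t = Complex.exp (((σ - t : ℝ) : ℂ) * E) / (1 + Complex.exp (-((β : ℂ) * E))) := by
  rw [fermiTimeKernel, if_neg (not_lt.2 h)]

/-- The branch `t < σ` of the kernel. [cite: PedraSalmhofer2008, §4.1] -/
theorem fermiTimeKernel_of_lt (β : ℝ) (E : ℂ) {σ t : ℝ} (h : t < σ) :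
    fermiTimeKernel β E σ t = -(Complex.exp (((σ - t : ℝ) : ℂ) * E) / (1 + Complex.exp ((β : ℂ) * E))) := by
  rw [fermiTimeKernel, if_pos h]

/-- **A uniform bound for the kernel on the window**: for `σ, t ∈ [0, β]`,
`‖K_β(E; σ, t)‖ ≤ e^{β‖E‖} · max(‖(1+e^{βE})⁻¹‖, ‖(1+e^{-βE})⁻¹‖)`. [cite: PedraSalmhofer2008, §4.1] -/
theorem norm_fermiTimeKernel_le {β : ℝ} (E : ℂ) {σ t : ℝ} (hσ : σ ∈ Icc 0 β) (ht : t ∈ Icc 0 β) :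
    ‖fermiTimeKernel β E σ t‖ ≤ Real.exp (β * ‖E‖) *
      max ‖(1 + Complex.exp ((β : ℂ) * E))⁻¹‖ ‖(1 + Complex.exp (-((β : ℂ) * E)))⁻¹‖ := by
  have hexp : ‖Complex.exp (((σ - t : ℝ) : ℂ) * E)‖ ≤ Real.exp (β * ‖E‖) := by
    rw [Complex.norm_exp]
    refine Real.exp_le_exp.2 ((Complex.re_le_norm _).trans ?_)
    rw [norm_mul, Complex.norm_real, Real.norm_eq_abs]
    refine mul_le_mul_of_nonneg_right (abs_le.2 ⟨?_, ?_⟩) (norm_nonneg _) <;> linarith [hσ.1, hσ.2, ht.1, ht.2]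
  unfold fermiTimeKernel
  split_ifs with h
  · rw [norm_neg, norm_div, div_eq_mul_inv, ← norm_inv]
    exact mul_le_mul hexp (le_max_left _ _) (norm_nonneg _) (Real.exp_pos _).le
  · rw [norm_div, div_eq_mul_inv, ← norm_inv]
    exact mul_le_mul hexp (le_max_right _ _) (norm_nonneg _) (Real.exp_pos _).le

/-- The kernel is interval-integrable in `σ` on `[0, t]` and on `[t, β]` (it is a branch of an exponential on each).
[cite: PedraSalmhofer2008, §4.1] -/
theorem intervalIntegrable_fermiTimeKernel_mul {β : ℝ} (E c : ℂ) {t : ℝ} (ht : t ∈ Icc 0 β) :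
    IntervalIntegrable (fun σ => Complex.exp (c * σ) * fermiTimeKernel β E σ t) volume 0 t ∧
      IntervalIntegrable (fun σ => Complex.exp (c * σ) * fermiTimeKernel β E σ t) volume t β := by
  constructor
  · -- on `Ι 0 t = Ioc 0 t` the kernel is the `σ ≤ t` branch
    have hcont : Continuous fun σ : ℝ => Complex.exp (c * σ) *
        (Complex.exp (((σ - t : ℝ) : ℂ) * E) / (1 + Complex.exp (-((β : ℂ) * E)))) := by fun_prop
    refine (intervalIntegrable_congr (μ := volume) ?_).1 (hcont.intervalIntegrable 0 t)
    intro σ hσ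
    rw [uIoc_of_le ht.1] at hσ
    simp only [fermiTimeKernel_of_le β E hσ.2]
  · have hcont : Continuous fun σ : ℝ => Complex.exp (c * σ) *
        -(Complex.exp (((σ - t : ℝ) : ℂ) * E) / (1 + Complex.exp ((β : ℂ) * E))) := by fun_prop
    refine (intervalIntegrable_congr (μ := volume) ?_).1 (hcont.intervalIntegrable t β)
    intro σ hσ
    rw [uIoc_of_le ht.2] at hσ
    simp only [fermiTimeKernel_of_lt β E hσ.1]

/-- **The fermionic Fourier coefficients of the time kernel are the free propagator**: if `e^{-iωβ} = -1` (fermionic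
frequency), `t ∈ [0, β]`, `1 + e^{βE} ≠ 0` (equivalently `1 + e^{-βE} ≠ 0`) and `E ≠ iω`, then
`∫₀^β e^{-iωσ} K_β(E; σ, t) dσ = e^{-iωt} / (E - iω)`. [cite: PedraSalmhofer2008, §2 (2.8)-(2.10)] -/
theorem integral_exp_mul_fermiTimeKernel {β ω : ℝ} (E : ℂ) {t : ℝ} (ht : t ∈ Icc 0 β)
    (hω : Complex.exp (-(((ω * β : ℝ) : ℂ) * Complex.I)) = -1)
    (hp : 1 + Complex.exp ((β : ℂ) * E) ≠ 0) (hE : E - (ω : ℂ) * Complex.I ≠ 0) :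
    ∫ σ in (0 : ℝ)..β, Complex.exp (-(((ω * σ : ℝ) : ℂ) * Complex.I)) * fermiTimeKernel β E σ t =
      Complex.exp (-(((ω * t : ℝ) : ℂ) * Complex.I)) / (E - (ω : ℂ) * Complex.I) := by
  set c : ℂ := -((ω : ℂ) * Complex.I) with hc
  have hcE : c + E = E - (ω : ℂ) * Complex.I := by rw [hc]; ring
  have hcE0 : c + E ≠ 0 := by rw [hcE]; exact hE
  have hexpσ : ∀ σ : ℝ, Complex.exp (-(((ω * σ : ℝ) : ℂ) * Complex.I)) = Complex.exp (c * σ) := by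
    intro σ; congr 1; rw [hc]; push_cast; ring
  simp_rw [hexpσ]
  obtain ⟨hI1, hI2⟩ := intervalIntegrable_fermiTimeKernel_mul E c ht
  rw [← integral_add_adjacent_intervals hI1 hI2]
  -- the two pieces as exponential integrals
  have hA : ∀ σ : ℝ, Complex.exp (c * σ) * Complex.exp (((σ - t : ℝ) : ℂ) * E) =
      Complex.exp (-((t : ℂ) * E)) * Complex.exp ((c + E) * σ) := by
    intro σ
    rw [← Complex.exp_add, ← Complex.exp_add]
    congr 1; push_cast; ring
  have h1 : ∫ σ in (0 : ℝ)..t, Complex.exp (c * σ) * fermiTimeKernel β E σ t =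
      Complex.exp (-((t : ℂ) * E)) / (1 + Complex.exp (-((β : ℂ) * E))) *
        ((Complex.exp ((c + E) * t) - 1) / (c + E)) := by
    have heq : ∀ σ ∈ Ι (0 : ℝ) t, Complex.exp (c * σ) * fermiTimeKernel β E σ t =
        Complex.exp (-((t : ℂ) * E)) / (1 + Complex.exp (-((β : ℂ) * E))) * Complex.exp ((c + E) * σ) := by
      intro σ hσ
      rw [uIoc_of_le ht.1] at hσ
      rw [fermiTimeKernel_of_le β E hσ.2, mul_div_assoc', hA]
      ring
    rw [integral_congr_ae (Filter.Eventually.of_forall heq), intervalIntegral.integral_const_mul, integral_exp_mul_complex hcE0]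
    simp
  have h2 : ∫ σ in t..β, Complex.exp (c * σ) * fermiTimeKernel β E σ t =
      -(Complex.exp (-((t : ℂ) * E)) / (1 + Complex.exp ((β : ℂ) * E))) *
        ((Complex.exp ((c + E) * β) - Complex.exp ((c + E) * t)) / (c + E)) := by
    have heq : ∀ σ ∈ Ι t β, Complex.exp (c * σ) * fermiTimeKernel β E σ t =
        -(Complex.exp (-((t : ℂ) * E)) / (1 + Complex.exp ((β : ℂ) * E))) * Complex.exp ((c + E) * σ) := by
      intro σ hσ
      rw [uIoc_of_le ht.2] at hσ
      rw [fermiTimeKernel_of_lt β E hσ.1, mul_neg, mul_div_assoc', hA]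
      ring
    rw [integral_congr_ae (Filter.Eventually.of_forall heq), intervalIntegral.integral_const_mul, integral_exp_mul_complex hcE0]
  rw [h1, h2]
  -- `e^{(c+E)β} = -e^{βE}` by the fermionic condition
  have hβE : Complex.exp ((c + E) * β) = -Complex.exp ((β : ℂ) * E) := by
    rw [add_mul, Complex.exp_add, hc]
    have : Complex.exp (-((ω : ℂ) * Complex.I) * (β : ℂ)) = -1 := by
      rw [← hω]; congr 1; push_cast; ring
    rw [this, mul_comm E]; ring
  rw [hβE, ← hcE]
  -- the algebra: boundary terms cancel since `e^{βE}/(1+e^{βE}) = 1/(1+e^{-βE})`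
  have hP : Complex.exp ((β : ℂ) * E) ≠ 0 := Complex.exp_ne_zero _
  have hT : Complex.exp ((t : ℂ) * E) ≠ 0 := Complex.exp_ne_zero _
  have hct : Complex.exp ((c + E) * t) = Complex.exp ((t : ℂ) * E) * Complex.exp (c * t) := by
    rw [← Complex.exp_add]; congr 1; ring
  have hm' : Complex.exp ((β : ℂ) * E) + 1 ≠ 0 := by rw [add_comm]; exact hp
  have hneg1 : Complex.exp (-((t : ℂ) * E)) = (Complex.exp ((t : ℂ) * E))⁻¹ := Complex.exp_neg _
  have hneg2 : Complex.exp (-((β : ℂ) * E)) = (Complex.exp ((β : ℂ) * E))⁻¹ := Complex.exp_neg _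
  have hp2 : 1 + Complex.exp (E * (β : ℂ)) ≠ 0 := by rw [mul_comm]; exact hp
  have hinv : (1 + Complex.exp (E * (β : ℂ)))⁻¹ * (1 + Complex.exp (E * (β : ℂ))) = 1 := inv_mul_cancel₀ hp2
  rw [hneg1, hneg2, hct, mul_comm (t : ℂ) E, mul_comm (β : ℂ) E]
  field_simp
  linear_combination (Complex.exp (E * ↑β) * Complex.exp (E * ↑t) * Complex.exp (↑t * c) - Complex.exp (E * ↑β)) * hinv

/-! ### The synthesis kernel of a finite family of fermionic frequencies and the row-average identity -/

variable {ι : Type*} [Fintype ι]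

/-- **The synthesis kernel** `F_c(s) = (1/β) Σ_n c_n e^{iω_n s}` of a finite family of weights `c_n` at the frequencies `ω_n`
(a smooth frequency cutoff read in imaginary time; Pedra–Salmhofer §2 (2.8)). [cite: PedraSalmhofer2008, §2 (2.8)] -/
def freqKernel (β : ℝ) (ω : ι → ℝ) (c : ι → ℂ) (s : ℝ) : ℂ :=
  ((1 / β : ℝ) : ℂ) * ∑ n, c n * Complex.exp (((ω n * s : ℝ) : ℂ) * Complex.I)

/-- **The row-average identity**: for fermionic frequencies (`e^{-iω_nβ} = -1`), `t ∈ [0, β]`, any real `τ` and any weights,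
`∫₀^β F_c(τ - σ) K_β(E; σ, t) dσ = (1/β) Σ_n c_n e^{iω_n(τ - t)}/(E - iω_n)` — the smoothly weighted frequency sum of the
free propagator `1/(E - iω) = 1/(-i(ω + θ) + ξ)` (`E = ξ - iθ`) is an average of time translates of the chronological kernel.
[cite: PedraSalmhofer2008, §2 (2.8)-(2.10)] -/
theorem integral_freqKernel_mul_fermiTimeKernel {β : ℝ} (ω : ι → ℝ) (c : ι → ℂ) (E : ℂ) (τ : ℝ) {t : ℝ}
    (ht : t ∈ Icc 0 β) (hω : ∀ n, Complex.exp (-(((ω n * β : ℝ) : ℂ) * Complex.I)) = -1)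
    (hp : 1 + Complex.exp ((β : ℂ) * E) ≠ 0) (hE : ∀ n, E - (ω n : ℂ) * Complex.I ≠ 0) :
    ∫ σ in (0 : ℝ)..β, freqKernel β ω c (τ - σ) * fermiTimeKernel β E σ t =
      ((1 / β : ℝ) : ℂ) * ∑ n, c n * (Complex.exp (((ω n * (τ - t) : ℝ) : ℂ) * Complex.I) / (E - (ω n : ℂ) * Complex.I)) := by
  -- expand the synthesis kernel and factor the `τ`-phase out of each term
  have hsplit : ∀ σ : ℝ, freqKernel β ω c (τ - σ) * fermiTimeKernel β E σ t =
      ((1 / β : ℝ) : ℂ) * ∑ n, (c n * Complex.exp (((ω n * τ : ℝ) : ℂ) * Complex.I)) *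
        (Complex.exp (-(((ω n * σ : ℝ) : ℂ) * Complex.I)) * fermiTimeKernel β E σ t) := by
    intro σ
    rw [freqKernel, mul_assoc, Finset.sum_mul]
    congr 1
    refine Finset.sum_congr rfl fun n _ => ?_
    have : Complex.exp (((ω n * (τ - σ) : ℝ) : ℂ) * Complex.I) =
        Complex.exp (((ω n * τ : ℝ) : ℂ) * Complex.I) * Complex.exp (-(((ω n * σ : ℝ) : ℂ) * Complex.I)) := by
      rw [← Complex.exp_add]; congr 1; push_cast; ring
    rw [this]; ring
  simp_rw [hsplit]
  have hint : ∀ n, IntervalIntegrable (fun σ => Complex.exp (-(((ω n * σ : ℝ) : ℂ) * Complex.I)) * fermiTimeKernel β E σ t)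
      volume 0 β := by
    intro n
    have hexpσ : ∀ σ : ℝ, Complex.exp (-(((ω n * σ : ℝ) : ℂ) * Complex.I)) = Complex.exp (-((ω n : ℂ) * Complex.I) * σ) := by
      intro σ; congr 1; push_cast; ring
    simp_rw [hexpσ]
    obtain ⟨h1, h2⟩ := intervalIntegrable_fermiTimeKernel_mul (β := β) E (-((ω n : ℂ) * Complex.I)) ht
    exact h1.trans h2
  rw [intervalIntegral.integral_const_mul, intervalIntegral.integral_finsetSum fun n _ => (hint n).const_mul _]
  congr 1
  refine Finset.sum_congr rfl fun n _ => ?_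
  rw [intervalIntegral.integral_const_mul, integral_exp_mul_fermiTimeKernel E ht (hω n) hp (hE n)]
  have hsum : Complex.exp (((ω n * (τ - t) : ℝ) : ℂ) * Complex.I) =
      Complex.exp (((ω n * τ : ℝ) : ℂ) * Complex.I) * Complex.exp (-(((ω n * t : ℝ) : ℂ) * Complex.I)) := by
    rw [← Complex.exp_add]; congr 1; push_cast; ring
  rw [hsum]
  ring

end Literature.MathematicalPhysics.QuantumLattice

end
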